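import Literature.NumberTheory.LFunctions.LandauOscillation
import Literature.NumberTheory.LFunctions.PrimeLogSeries
import Mathlib.NumberTheory.Harmonic.GammaDeriv
import Mathlib.Analysis.SpecialFunctions.Gamma.Deriv
import Mathlib.MeasureTheory.Function.JacobianOneDim
import Mathlib.NumberTheory.LSeries.Nonvanishing
import Mathlib.Analysis.SpecialFunctions.Integrability.Basic
import Mathlib.Analysis.Complex.RemovableSingularity
import HarnessLib

/-!
# Nicolas's comparison function and its Mellin transform (towards Robin 1984, §4 Prop. 1)

Topic: `Literature/NumberTheory/LFunctions`. Second step of the discharge of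
`Literature.NumberTheory.LFunctions.Robin1984_sigma_oscillation` (Lagarias 2002 Prop. 3.2 = Robin 1984 §4 Prop. 1: if RH fails,
`σ(n)/n > e^γ log log n (1 + c (log n)^{-β})` infinitely often), by the method of Nicolas (1983,
Thm. 3 (c)) and Landau's theorem (`LandauOscillation.lean`).

We study the comparison function
`g(x) = c x^{-b} + γ + log log x + E(x) - A(x)`, `A(x) = ∑_{p ≤ x} -log(1 - 1/p)`
(`mertensLog`), `E(x) = (ψ(x) - x)/(x log x)` for `x ≥ 2` (`psiError`), whose eventual
non-negativity is the negation of the `Ω₊`-statement we are after, and the transform of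
`g₁ = g · log`, `F₁(s) = ∫_1^∞ g(x) log x · x^{-s-1} dx`. Main results (all proved):

* the five Mellin transforms: `∫_1^∞ x^{-b} x^{-s-1} = 1/(s+b)`,
  `∫_1^∞ log log x · x^{-s-1} dx = -(γ + log s)/s` (`mellinIoi_loglog`, via `Γ'(1) = -γ`,
  Mathlib `Complex.hasDerivAt_Gamma_one`), `∫_2^∞ (ψ(x)-x)/x · x^{-s-1} dx = -e(s)` with
  `e(s) = ζ'/ζ(1+s)/(s+1) + 2^{-s}/s` (`mellinIoi_psiError_mul_log`), and
  `∫_1^∞ A(x) x^{-s-1} dx = (∑ a_n n^{-s})/s`;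
* `mellinIoi_nicolasFnLog`: for `Re s > 1`, `F₁(s) = Φ₁(s) := c/(s+b)² + M'(s) - e(s)`, where
  `M = dslope N 0`, `N(s) = log (s ζ(1+s)) + primeLogDiff s` (`nicolasCont`);
* `differentiableOn_nicolasCont`: `Φ₁` is holomorphic on `{Re s > 1} ∪ W₀` for a thin open
  rectangle `W₀ ⊇ [-b, 3]` (`0 < b < 1/2`), because `s ζ(1+s)` is real and positive on
  `(-1/2, ∞)` (no zeros of `ζ` on `(1/2, 1)`) so that the principal logarithm is analytic near the
  segment, and the pole of `ζ` cancels (`zetaOne`, `dslope`);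
* `integrableOn_nicolasFnLog_of_nonneg`: **Landau's theorem applied**: if `g ≥ 0` on some
  `(X₁, ∞)` then `∫_1^∞ |g₁| x^{-σ-1} dx < ∞` for every `σ > -b`, so that `F₁` is holomorphic on
  `Re s > -b` (`differentiableOn_mellinIoi_nicolasFnLog_of_nonneg`).

The contradiction with a zero of `ζ` off the critical line is derived in `NicolasOmega.lean`.

## References

* J.-L. Nicolas, *Petites valeurs de la fonction d'Euler*, J. Number Theory 17 (1983), 375–388:
  Thm. 3 (c) (p. 376) and §4 "Si l'hypothèse de Riemann est fausse" (pp. 383–386): Lemme 2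
  (Landau's lemma), formulas (21)–(23), and Prop. 3 (`J(x) = Ω±(x^{-b})` for
  `1 - θ < b < 1/2`).
* G. Robin, J. Math. Pures Appl. 63 (1984), 187–213, §4 Prop. 1.
* H. L. Montgomery, R. C. Vaughan, *Multiplicative Number Theory I*, CUP 2007, §15.1
  (Lemma 15.1 and the proof of Thm. 15.2: the method).
-/

noncomputable section

open Complex Filter Topology Set MeasureTheory Real

namespace Literature.NumberTheory.LFunctions

namespace Nicolas

open Landau

/-! ### Generic facts on the transform `mellinIoi` -/

section generic

variable {g f : ℝ → ℝ}

/-- Bridge to Mathlib's Mellin transform (`mellin f s = ∫_{(0,∞)} t^{s-1} • f t`):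
`mellinIoi g s = mellin (𝟙_{(1,∞)} · g) (-s)`, so that results stated for `mellin` (e.g. in
`VonKochConverse.lean`) and for `mellinIoi` (`LandauOscillation.lean`) can be exchanged.
[folklore] -/
theorem mellinIoi_eq_mellin_indicator (g : ℝ → ℝ) (s : ℂ) :
    mellinIoi g s = mellin ((Ioi (1 : ℝ)).indicator fun x : ℝ ↦ (g x : ℂ)) (-s) := by
  rw [mellinIoi, mellin]
  have h : ∀ t : ℝ, (t : ℂ) ^ (-s - 1) • (Ioi (1 : ℝ)).indicator (fun x : ℝ ↦ (g x : ℂ)) t =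
      (Ioi (1 : ℝ)).indicator (fun x : ℝ ↦ (g x : ℂ) * (x : ℂ) ^ (-(s + 1))) t := by
    intro t
    by_cases ht : t ∈ Ioi (1 : ℝ)
    · rw [Set.indicator_of_mem ht, Set.indicator_of_mem ht, smul_eq_mul, mul_comm,
        show -s - 1 = -(s + 1) by ring]
    · rw [Set.indicator_of_notMem ht, Set.indicator_of_notMem ht, smul_zero]
  simp_rw [h]
  rw [setIntegral_indicator measurableSet_Ioi,
    Set.inter_eq_right.2 (Set.Ioi_subset_Ioi zero_le_one)]

/-- The complex integrand is integrable for `Re s > σ₁`. [folklore] -/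
theorem integrable_ofReal_mul_cpow (hg : Measurable g) {σ₁ : ℝ}
    (hint : IntegrableOn (fun x ↦ g x * x ^ (-(σ₁ + 1))) (Ioi 1)) {s : ℂ} (hs : σ₁ < s.re) :
    Integrable (fun x : ℝ ↦ (g x : ℂ) * (x : ℂ) ^ (-(s + 1))) (volume.restrict (Ioi 1)) := by
  have := integrable_mellinIntegrand hg hint 0 hs
  refine this.congr (Eventually.of_forall fun x ↦ ?_)
  simp [mellinIntegrand]

/-- Auxiliary (proof-internal). [folklore] -/
theorem mellinIoi_add' {s : ℂ}
    (hf : Integrable (fun x : ℝ ↦ (f x : ℂ) * (x : ℂ) ^ (-(s + 1))) (volume.restrict (Ioi 1)))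
    (hg : Integrable (fun x : ℝ ↦ (g x : ℂ) * (x : ℂ) ^ (-(s + 1))) (volume.restrict (Ioi 1))) :
    mellinIoi (fun x ↦ f x + g x) s = mellinIoi f s + mellinIoi g s := by
  unfold mellinIoi
  rw [← integral_add hf hg]
  refine setIntegral_congr_fun measurableSet_Ioi fun x _ ↦ ?_
  push_cast
  ring

/-- Auxiliary (proof-internal). [folklore] -/
theorem mellinIoi_sub' {s : ℂ}
    (hf : Integrable (fun x : ℝ ↦ (f x : ℂ) * (x : ℂ) ^ (-(s + 1))) (volume.restrict (Ioi 1)))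
    (hg : Integrable (fun x : ℝ ↦ (g x : ℂ) * (x : ℂ) ^ (-(s + 1))) (volume.restrict (Ioi 1))) :
    mellinIoi (fun x ↦ f x - g x) s = mellinIoi f s - mellinIoi g s := by
  unfold mellinIoi
  rw [← integral_sub hf hg]
  refine setIntegral_congr_fun measurableSet_Ioi fun x _ ↦ ?_
  push_cast
  ring

/-- Auxiliary (proof-internal). [folklore] -/
theorem mellinIoi_const_mul (c : ℝ) (s : ℂ) :
    mellinIoi (fun x ↦ c * g x) s = c * mellinIoi g s := by
  unfold mellinIoi
  rw [← integral_const_mul]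
  refine setIntegral_congr_fun measurableSet_Ioi fun x _ ↦ ?_
  push_cast
  ring

/-- Integrability of a sum. [folklore] -/
theorem integrableOn_add_rpow {σ : ℝ} (hf : IntegrableOn (fun x ↦ f x * x ^ (-(σ + 1))) (Ioi 1))
    (hg : IntegrableOn (fun x ↦ g x * x ^ (-(σ + 1))) (Ioi 1)) :
    IntegrableOn (fun x ↦ (f x + g x) * x ^ (-(σ + 1))) (Ioi 1) := by
  have := hf.add hg
  refine this.congr ?_
  exact Eventually.of_forall fun x ↦ by simp only [Pi.add_apply]; ring

/-- Auxiliary (proof-internal). [folklore] -/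
theorem integrableOn_sub_rpow {σ : ℝ} (hf : IntegrableOn (fun x ↦ f x * x ^ (-(σ + 1))) (Ioi 1))
    (hg : IntegrableOn (fun x ↦ g x * x ^ (-(σ + 1))) (Ioi 1)) :
    IntegrableOn (fun x ↦ (f x - g x) * x ^ (-(σ + 1))) (Ioi 1) := by
  have := hf.sub hg
  refine this.congr ?_
  exact Eventually.of_forall fun x ↦ by simp only [Pi.sub_apply]; ring

/-- Auxiliary (proof-internal). [folklore] -/
theorem integrableOn_const_mul_rpow {σ : ℝ} (c : ℝ)
    (hg : IntegrableOn (fun x ↦ g x * x ^ (-(σ + 1))) (Ioi 1)) :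
    IntegrableOn (fun x ↦ (c * g x) * x ^ (-(σ + 1))) (Ioi 1) := by
  have := hg.const_mul c
  refine this.congr ?_
  exact Eventually.of_forall fun x ↦ by ring

/-- A bounded measurable function is integrable against `x^{-(σ+1)}` on `(1,∞)` for `σ > 0`.
[folklore] -/
theorem integrableOn_rpow_of_bounded (hg : Measurable g) {C : ℝ} (hC : ∀ x, 1 < x → |g x| ≤ C)
    {σ : ℝ} (hσ : 0 < σ) : IntegrableOn (fun x ↦ g x * x ^ (-(σ + 1))) (Ioi 1) := by
  have h1 : IntegrableOn (fun x : ℝ ↦ C * x ^ (-(σ + 1))) (Ioi 1) :=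
    (integrableOn_Ioi_rpow_of_lt (by linarith) zero_lt_one).const_mul C
  refine Integrable.mono' h1 ((hg.mul (measurable_id.pow_const _))).aestronglyMeasurable ?_
  rw [ae_restrict_iff' measurableSet_Ioi]
  refine Eventually.of_forall fun x (hx : 1 < x) ↦ ?_
  have hx0 : 0 < x := zero_lt_one.trans hx
  rw [norm_mul, Real.norm_eq_abs, Real.norm_eq_abs, abs_of_pos (Real.rpow_pos_of_pos hx0 _)]
  exact mul_le_mul_of_nonneg_right (hC x hx) (Real.rpow_pos_of_pos hx0 _).le

/-- A measurable function with `|g x| ≤ C (1 + log x)` is integrable against `x^{-(σ+1)}` on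
`(1,∞)` for every `σ > 0`. [folklore] -/
theorem integrableOn_rpow_of_le_log (hg : Measurable g) {C : ℝ}
    (hC : ∀ x, 1 < x → |g x| ≤ C * (1 + Real.log x)) {σ : ℝ} (hσ : 0 < σ) :
    IntegrableOn (fun x ↦ g x * x ^ (-(σ + 1))) (Ioi 1) := by
  -- `1 + log x ≤ (1 + 2/σ) x^{σ/2}` for `x ≥ 1`
  have hC0 : 0 ≤ C := by
    have := hC 2 (by norm_num)
    have h2 : 0 < 1 + Real.log 2 := by have := Real.log_pos (show (1:ℝ) < 2 by norm_num); linarith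
    nlinarith [abs_nonneg (g 2)]
  have h1 : IntegrableOn (fun x : ℝ ↦ C * (1 + 2 / σ) * x ^ (-(σ / 2 + 1))) (Ioi 1) :=
    (integrableOn_Ioi_rpow_of_lt (by linarith) zero_lt_one).const_mul _
  refine Integrable.mono' h1 ((hg.mul (measurable_id.pow_const _))).aestronglyMeasurable ?_
  rw [ae_restrict_iff' measurableSet_Ioi]
  refine Eventually.of_forall fun x (hx : 1 < x) ↦ ?_
  have hx0 : 0 < x := zero_lt_one.trans hx
  rw [norm_mul, Real.norm_eq_abs, Real.norm_eq_abs, abs_of_pos (Real.rpow_pos_of_pos hx0 _)]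
  have hlog : Real.log x ≤ x ^ (σ / 2) / (σ / 2) := Real.log_le_rpow_div hx0.le (by linarith)
  have hone : (1 : ℝ) ≤ x ^ (σ / 2) := Real.one_le_rpow hx.le (by linarith)
  have h2 : 1 + Real.log x ≤ (1 + 2 / σ) * x ^ (σ / 2) := by
    rw [add_mul, one_mul]
    have : x ^ (σ / 2) / (σ / 2) = 2 / σ * x ^ (σ / 2) := by field_simp
    linarith
  calc |g x| * x ^ (-(σ + 1)) ≤ C * (1 + Real.log x) * x ^ (-(σ + 1)) := by
        gcongr; exact hC x hx
    _ ≤ C * ((1 + 2 / σ) * x ^ (σ / 2)) * x ^ (-(σ + 1)) := by gcongr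
    _ = C * (1 + 2 / σ) * x ^ (-(σ / 2 + 1)) := by
        rw [mul_assoc, mul_assoc, ← Real.rpow_add hx0, show σ / 2 + -(σ + 1) = -(σ / 2 + 1) by ring]
        ring

/-- **The transform of `g · log` is `-F'`** (differentiation under the integral sign,
`LandauOscillation.lean`). [cite: MontgomeryVaughan2007, §15.1 Lemma 15.1] -/
theorem mellinIoi_mul_log (hg : Measurable g) {σ₁ : ℝ}
    (hint : IntegrableOn (fun x ↦ g x * x ^ (-(σ₁ + 1))) (Ioi 1)) {s : ℂ} (hs : σ₁ < s.re) :
    mellinIoi (fun x ↦ g x * Real.log x) s = -deriv (mellinIoi g) s := by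
  have h := hasDerivAt_mellinIoiLog hg hint 0 hs
  rw [mellinIoiLog_zero] at h
  rw [h.deriv, mellinIoiLog, mellinIoi, ← integral_neg]
  refine setIntegral_congr_fun measurableSet_Ioi fun x _ ↦ ?_
  simp only [mellinIntegrand, zero_add, pow_one]
  push_cast
  ring

/-- Integrability of `g · log` against `x^{-(σ+1)}` from that of `g` at a smaller exponent.
[cite: MontgomeryVaughan2007, §15.1 Lemma 15.1] -/
theorem integrableOn_mul_log_rpow (hg : Measurable g) {σ₁ : ℝ}
    (hint : IntegrableOn (fun x ↦ g x * x ^ (-(σ₁ + 1))) (Ioi 1)) {σ : ℝ} (hσ : σ₁ < σ) :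
    IntegrableOn (fun x ↦ (g x * Real.log x) * x ^ (-(σ + 1))) (Ioi 1) := by
  have := integrable_logpow_rpow hg hint 1 hσ
  rw [IntegrableOn]
  refine this.congr (Eventually.of_forall fun x ↦ ?_)
  simp only [pow_one]

end generic

/-! ### The power and constant pieces -/

/-- `∫_1^∞ x^{-b} x^{-s-1} dx = 1/(s+b)` for `Re s > -b`. [folklore] -/
theorem mellinIoi_rpow_neg {b : ℝ} {s : ℂ} (hs : -b < s.re) :
    mellinIoi (fun x ↦ x ^ (-b)) s = 1 / (s + b) := by
  unfold mellinIoi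
  have hsb : s + b ≠ 0 := by
    intro h
    have := congrArg Complex.re h
    simp at this
    linarith
  have h1 : ∀ x ∈ Ioi (1 : ℝ),
      (((x ^ (-b) : ℝ)) : ℂ) * (x : ℂ) ^ (-(s + 1)) = (x : ℂ) ^ (-(s + b + 1)) := by
    intro x hx
    have hx0 : (0 : ℝ) < x := zero_lt_one.trans hx
    rw [ofReal_cpow hx0.le, ← cpow_add _ _ (ofReal_ne_zero.2 hx0.ne')]
    push_cast
    ring_nf
  rw [setIntegral_congr_fun measurableSet_Ioi h1, integral_Ioi_cpow_of_lt _ zero_lt_one]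
  · rw [ofReal_one, one_cpow, show -(s + ↑b + 1) + 1 = -(s + b) by ring, neg_div_neg_eq]
  · simp only [neg_add_rev, add_re, neg_re, one_re, ofReal_re]
    linarith

/-- Auxiliary (proof-internal). [folklore] -/
theorem integrableOn_rpow_neg_rpow {b σ : ℝ} (hσ : -b < σ) :
    IntegrableOn (fun x : ℝ ↦ x ^ (-b) * x ^ (-(σ + 1))) (Ioi 1) := by
  have h := integrableOn_Ioi_rpow_of_lt (a := -(b + σ + 1)) (by linarith) zero_lt_one
  refine h.congr_fun (fun x hx ↦ ?_) measurableSet_Ioi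
  have hx0 : (0 : ℝ) < x := zero_lt_one.trans hx
  rw [← Real.rpow_add hx0]
  ring_nf

/-- Auxiliary (proof-internal). [folklore] -/
theorem measurable_rpow_neg (b : ℝ) : Measurable fun x : ℝ ↦ x ^ (-b) :=
  measurable_id.pow_const _

/-- `∫_1^∞ x^{-b} log x · x^{-s-1} dx = 1/(s+b)²` for `Re s > -b`. [folklore] -/
theorem mellinIoi_rpow_neg_mul_log {b : ℝ} {s : ℂ} (hs : -b < s.re) :
    mellinIoi (fun x ↦ x ^ (-b) * Real.log x) s = 1 / (s + b) ^ 2 := by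
  set σ₁ : ℝ := (-b + s.re) / 2 with hσ₁
  have h1 : -b < σ₁ := by rw [hσ₁]; linarith
  have h2 : σ₁ < s.re := by rw [hσ₁]; linarith
  rw [mellinIoi_mul_log (measurable_rpow_neg b) (integrableOn_rpow_neg_rpow h1) h2]
  have hev : mellinIoi (fun x ↦ x ^ (-b)) =ᶠ[𝓝 s] fun z ↦ 1 / (z + b) := by
    filter_upwards [(isOpen_re_gt (-b)).mem_nhds hs] with z hz
    exact mellinIoi_rpow_neg hz
  rw [hev.deriv_eq]
  have hsb : s + b ≠ 0 := by
    intro h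
    have := congrArg Complex.re h
    simp at this
    linarith
  have hd : HasDerivAt (fun z : ℂ ↦ 1 / (z + b)) ((0 * (s + b) - 1 * 1) / (s + b) ^ 2) s :=
    (hasDerivAt_const s (1 : ℂ)).div ((hasDerivAt_id s).add_const (b : ℂ)) hsb
  rw [hd.deriv]
  field_simp
  ring

/-- `∫_1^∞ γ log x · x^{-s-1} dx = γ/s²` for `Re s > 0`. [folklore] -/
theorem mellinIoi_const_mul_log (γ : ℝ) {s : ℂ} (hs : 0 < s.re) :
    mellinIoi (fun x ↦ γ * Real.log x) s = γ / s ^ 2 := by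
  have h : mellinIoi (fun x ↦ γ * Real.log x) s =
      γ * mellinIoi (fun x ↦ x ^ (-(0:ℝ)) * Real.log x) s := by
    rw [← mellinIoi_const_mul]
    congr 1
    funext x
    simp
  rw [h, mellinIoi_rpow_neg_mul_log (b := 0) (by simpa using hs)]
  simp
  ring

/-- Auxiliary (proof-internal). [folklore] -/
theorem integrableOn_const_rpow (γ : ℝ) {σ : ℝ} (hσ : 0 < σ) :
    IntegrableOn (fun x : ℝ ↦ γ * x ^ (-(σ + 1))) (Ioi 1) :=
  (integrableOn_Ioi_rpow_of_lt (by linarith) zero_lt_one).const_mul γ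

/-! ### The piece `log log x`: `∫_1^∞ log log x · x^{-s-1} dx = -(γ + log s)/s` -/

/-- `∫_0^∞ log t · e^{-t} dt` converges absolutely. [folklore] -/
theorem integrableOn_log_mul_exp_neg :
    IntegrableOn (fun t : ℝ ↦ Real.log t * Real.exp (-t)) (Ioi 0) := by
  have hmeas : Measurable fun t : ℝ ↦ Real.log t * Real.exp (-t) :=
    Real.measurable_log.mul (Real.measurable_exp.comp measurable_neg)
  rw [← Ioc_union_Ioi_eq_Ioi zero_le_one]
  refine IntegrableOn.union ?_ ?_
  · -- on `(0,1]`: `|log t e^{-t}| ≤ |log t|`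
    have h1 : IntegrableOn Real.log (Ioc 0 1) :=
      (intervalIntegral.intervalIntegrable_log' (a := 0) (b := 1)).1
    refine Integrable.mono' h1.norm hmeas.aestronglyMeasurable ?_
    rw [ae_restrict_iff' measurableSet_Ioc]
    refine Eventually.of_forall fun t ht ↦ ?_
    simp only [norm_mul, Real.norm_eq_abs, abs_of_pos (Real.exp_pos _)]
    refine mul_le_of_le_one_right (abs_nonneg _) ?_
    rw [Real.exp_le_one_iff]
    linarith [ht.1]
  · -- on `(1,∞)`: `|log t e^{-t}| ≤ t e^{-t}`
    have h1 : IntegrableOn (fun t : ℝ ↦ Real.exp (-t) * t ^ ((2 : ℝ) - 1)) (Ioi 1) :=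
      (Real.GammaIntegral_convergent (s := 2) (by norm_num)).mono_set (Ioi_subset_Ioi zero_le_one)
    refine Integrable.mono' h1 hmeas.aestronglyMeasurable ?_
    rw [ae_restrict_iff' measurableSet_Ioi]
    refine Eventually.of_forall fun t (ht : 1 < t) ↦ ?_
    have ht0 : 0 < t := zero_lt_one.trans ht
    rw [norm_mul, Real.norm_eq_abs, Real.norm_eq_abs, abs_of_pos (Real.exp_pos _),
      abs_of_nonneg (Real.log_nonneg ht.le), show (2 : ℝ) - 1 = 1 by norm_num, Real.rpow_one,
      mul_comm]
    gcongr
    linarith [Real.log_le_sub_one_of_pos ht0]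

/-- **`∫_0^∞ log t · e^{-t} dt = Γ'(1) = -γ`** (Mathlib: `Complex.hasDerivAt_Gamma_one`,
`Complex.hasDerivAt_GammaIntegral`). [folklore] -/
theorem integral_log_mul_exp_neg :
    ∫ t in Ioi (0 : ℝ), Real.log t * Real.exp (-t) = -Real.eulerMascheroniConstant := by
  have h1 := Complex.hasDerivAt_GammaIntegral (s := 1) (by simp)
  have h2 : HasDerivAt Complex.Gamma
      (∫ t in Ioi (0 : ℝ), (t : ℂ) ^ ((1 : ℂ) - 1) * ((Real.log t : ℂ) * (Real.exp (-t) : ℂ)))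
      1 := by
    refine h1.congr_of_eventuallyEq ?_
    filter_upwards [(isOpen_re_gt 0).mem_nhds (show (1 : ℂ) ∈ {s : ℂ | (0:ℝ) < s.re} by simp)]
      with s hs
    exact Complex.Gamma_eq_integral hs
  have h3 := h2.unique Complex.hasDerivAt_Gamma_one
  have h4 : ∫ t in Ioi (0 : ℝ), (t : ℂ) ^ ((1 : ℂ) - 1) * ((Real.log t : ℂ) * (Real.exp (-t) : ℂ)) =
      ((∫ t in Ioi (0 : ℝ), Real.log t * Real.exp (-t) : ℝ) : ℂ) := by
    rw [← integral_complex_ofReal]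
    refine setIntegral_congr_fun measurableSet_Ioi fun t _ ↦ ?_
    simp
  rw [h4] at h3
  exact_mod_cast h3

/-- The substitution `x = exp(v/σ)` maps `(0,∞)` onto `(1,∞)`. [folklore] -/
theorem image_exp_div_Ioi {σ : ℝ} (hσ : 0 < σ) :
    (fun v : ℝ ↦ Real.exp (v / σ)) '' Ioi 0 = Ioi 1 := by
  ext x
  constructor
  · rintro ⟨v, hv, rfl⟩
    exact Real.one_lt_exp_iff.2 (div_pos hv hσ)
  · intro hx
    refine ⟨σ * Real.log x, mul_pos hσ (Real.log_pos hx), ?_⟩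
    simp only
    rw [mul_div_cancel_left₀ _ hσ.ne', Real.exp_log (zero_lt_one.trans hx)]

/-- Auxiliary (proof-internal). [folklore] -/
theorem hasDerivAt_exp_div (σ v : ℝ) :
    HasDerivAt (fun v : ℝ ↦ Real.exp (v / σ)) (Real.exp (v / σ) / σ) v := by
  have h := ((hasDerivAt_id v).div_const σ).exp
  simp only [id_eq] at h
  convert h using 1
  ring

/-- Auxiliary (proof-internal). [folklore] -/
theorem injOn_exp_div {σ : ℝ} (hσ : 0 < σ) : InjOn (fun v : ℝ ↦ Real.exp (v / σ)) (Ioi 0) := by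
  intro v _ w _ h
  have := Real.exp_injective h
  field_simp at this
  linarith [this]

/-- The pulled-back integrand: for `v > 0`, `σ > 0`,
`|d/dv e^{v/σ}| · (log log e^{v/σ}) (e^{v/σ})^{-(σ+1)} = σ⁻¹ (log v - log σ) e^{-v}`. [folklore] -/
theorem loglog_pullback {σ : ℝ} (hσ : 0 < σ) {v : ℝ} (hv : 0 < v) :
    |Real.exp (v / σ) / σ| *
        (Real.log (Real.log (Real.exp (v / σ))) * Real.exp (v / σ) ^ (-(σ + 1))) =
      σ⁻¹ * ((Real.log v - Real.log σ) * Real.exp (-v)) := by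
  have hσ0 : σ ≠ 0 := hσ.ne'
  rw [abs_of_pos (div_pos (Real.exp_pos _) hσ), Real.log_exp, Real.log_div hv.ne' hσ0,
    ← Real.exp_mul]
  have h : Real.exp (v / σ) * Real.exp (v / σ * -(σ + 1)) = Real.exp (-v) := by
    rw [← Real.exp_add]
    congr 1
    field_simp
    ring
  calc Real.exp (v / σ) / σ * ((Real.log v - Real.log σ) * Real.exp (v / σ * -(σ + 1)))
      = σ⁻¹ * ((Real.log v - Real.log σ) * (Real.exp (v / σ) * Real.exp (v / σ * -(σ + 1)))) := by
        ring
    _ = σ⁻¹ * ((Real.log v - Real.log σ) * Real.exp (-v)) := by rw [h]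

/-- `log log x · x^{-(σ+1)}` is integrable on `(1,∞)` for `σ > 0`. [folklore] -/
theorem integrableOn_loglog_rpow {σ : ℝ} (hσ : 0 < σ) :
    IntegrableOn (fun x : ℝ ↦ Real.log (Real.log x) * x ^ (-(σ + 1))) (Ioi 1) := by
  rw [← image_exp_div_Ioi hσ,
    integrableOn_image_iff_integrableOn_abs_deriv_smul measurableSet_Ioi
      (fun v _ ↦ (hasDerivAt_exp_div σ v).hasDerivWithinAt) (injOn_exp_div hσ)]
  have h : IntegrableOn (fun v : ℝ ↦ σ⁻¹ * ((Real.log v - Real.log σ) * Real.exp (-v)))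
      (Ioi 0) := by
    refine Integrable.const_mul ?_ _
    have h1 : IntegrableOn (fun v : ℝ ↦ Real.log v * Real.exp (-v)) (Ioi 0) :=
      integrableOn_log_mul_exp_neg
    have h2 : IntegrableOn (fun v : ℝ ↦ Real.log σ * Real.exp (-v)) (Ioi 0) :=
      (integrableOn_exp_neg_Ioi 0).const_mul _
    exact (h1.sub h2).congr (Eventually.of_forall fun v ↦ by simp only [Pi.sub_apply]; ring)
  refine h.congr_fun (fun v hv ↦ ?_) measurableSet_Ioi
  rw [smul_eq_mul, loglog_pullback hσ hv]

/-- **`∫_1^∞ log log x · x^{-σ-1} dx = -(γ + log σ)/σ`** for real `σ > 0` (substitute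
`x = e^{v/σ}` and use `∫_0^∞ log v e^{-v} dv = -γ`, `∫_0^∞ e^{-v} dv = 1`). [folklore] -/
theorem integral_loglog_rpow {σ : ℝ} (hσ : 0 < σ) :
    ∫ x in Ioi (1 : ℝ), Real.log (Real.log x) * x ^ (-(σ + 1)) =
      -(Real.eulerMascheroniConstant + Real.log σ) / σ := by
  rw [← image_exp_div_Ioi hσ,
    integral_image_eq_integral_abs_deriv_smul measurableSet_Ioi
      (fun v _ ↦ (hasDerivAt_exp_div σ v).hasDerivWithinAt) (injOn_exp_div hσ)]
  have h1 : ∫ v in Ioi (0 : ℝ), |Real.exp (v / σ) / σ| •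
      (Real.log (Real.log (Real.exp (v / σ))) * Real.exp (v / σ) ^ (-(σ + 1))) =
      ∫ v in Ioi (0 : ℝ), σ⁻¹ * ((Real.log v - Real.log σ) * Real.exp (-v)) :=
    setIntegral_congr_fun measurableSet_Ioi fun v hv ↦ by rw [smul_eq_mul, loglog_pullback hσ hv]
  rw [h1, integral_const_mul]
  have h2 : ∫ v in Ioi (0 : ℝ), (Real.log v - Real.log σ) * Real.exp (-v) =
      (∫ v in Ioi (0 : ℝ), Real.log v * Real.exp (-v)) -
        Real.log σ * ∫ v in Ioi (0 : ℝ), Real.exp (-v) := by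
    rw [← integral_const_mul, ← integral_sub integrableOn_log_mul_exp_neg
      ((integrableOn_exp_neg_Ioi 0).const_mul _)]
    refine setIntegral_congr_fun measurableSet_Ioi fun v _ ↦ ?_
    ring
  rw [h2, integral_log_mul_exp_neg, integral_exp_neg_Ioi_zero]
  field_simp
  ring

/-- Auxiliary (proof-internal). [folklore] -/
theorem measurable_loglog : Measurable fun x : ℝ ↦ Real.log (Real.log x) :=
  Real.measurable_log.comp Real.measurable_log

/-- **`∫_1^∞ log log x · x^{-s-1} dx = -(γ + log s)/s`** for `Re s > 0` (from the real case by
analytic continuation). [folklore] -/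
theorem mellinIoi_loglog {s : ℂ} (hs : 0 < s.re) :
    mellinIoi (fun x ↦ Real.log (Real.log x)) s =
      -(Real.eulerMascheroniConstant + Complex.log s) / s := by
  -- the real case
  have hreal : ∀ y : ℝ, 0 < y → mellinIoi (fun x ↦ Real.log (Real.log x)) y =
      -(Real.eulerMascheroniConstant + Complex.log y) / y := by
    intro y hy
    have h := mellinIoiLog_ofReal (g := fun x ↦ Real.log (Real.log x)) 0 y
    rw [mellinIoiLog_zero] at h
    rw [h]
    simp only [pow_zero, one_mul, mul_one]
    rw [integral_loglog_rpow hy, ← ofReal_log hy.le]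
    push_cast
    ring
  -- analytic continuation
  set U : Set ℂ := {s : ℂ | (0 : ℝ) < s.re} with hU
  have hf : AnalyticOnNhd ℂ (mellinIoi fun x ↦ Real.log (Real.log x)) U := by
    refine DifferentiableOn.analyticOnNhd ?_ (isOpen_re_gt 0)
    exact differentiableOn_mellinIoi_of_forall measurable_loglog fun σ' hσ' ↦
      integrableOn_loglog_rpow hσ'
  have hg : AnalyticOnNhd ℂ (fun s ↦ -(Real.eulerMascheroniConstant + Complex.log s) / s) U := by
    refine DifferentiableOn.analyticOnNhd (fun z hz ↦ ?_) (isOpen_re_gt 0)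
    simp only [hU, Set.mem_setOf_eq] at hz
    have hz0 : z ≠ 0 := by rintro rfl; simp at hz
    refine DifferentiableAt.differentiableWithinAt ?_
    refine ((differentiableAt_const _).add (differentiableAt_id.clog (Or.inl hz))).neg.div
      differentiableAt_id hz0
  have h1U : ((1 : ℝ) : ℂ) ∈ U := by simp [hU]
  exact hf.eqOn_of_preconnected_of_frequently_eq hg (isPreconnected_re_gt 0) h1U
    (frequently_ofReal_gt (a := 0) one_pos hreal) hs

/-- `∫_1^∞ log log x · log x · x^{-s-1} dx = (1 - γ - log s)/s²` for `Re s > 0`. [folklore] -/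
theorem mellinIoi_loglog_mul_log {s : ℂ} (hs : 0 < s.re) :
    mellinIoi (fun x ↦ Real.log (Real.log x) * Real.log x) s =
      (1 - Real.eulerMascheroniConstant - Complex.log s) / s ^ 2 := by
  set σ₁ : ℝ := s.re / 2 with hσ₁
  have h1 : 0 < σ₁ := by rw [hσ₁]; linarith
  have h2 : σ₁ < s.re := by rw [hσ₁]; linarith
  rw [mellinIoi_mul_log measurable_loglog (integrableOn_loglog_rpow h1) h2]
  have hev : mellinIoi (fun x ↦ Real.log (Real.log x)) =ᶠ[𝓝 s]
      fun z ↦ -(Real.eulerMascheroniConstant + Complex.log z) / z := by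
    filter_upwards [(isOpen_re_gt 0).mem_nhds hs] with z hz
    exact mellinIoi_loglog hz
  rw [hev.deriv_eq]
  have hs0 : s ≠ 0 := by rintro rfl; simp at hs
  have hfun : (fun z : ℂ ↦ -(Real.eulerMascheroniConstant + Complex.log z) / z) =
      fun z ↦ (-(Real.eulerMascheroniConstant : ℂ) - Complex.log z) / z := by
    funext z; ring
  rw [hfun]
  have hd : HasDerivAt (fun z : ℂ ↦ (-(Real.eulerMascheroniConstant : ℂ) - Complex.log z) / z)
      (((-(s⁻¹)) * s - (-(Real.eulerMascheroniConstant : ℂ) - Complex.log s) * 1) / s ^ 2) s :=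
    ((Complex.hasDerivAt_log (Or.inl hs)).const_sub _).div (hasDerivAt_id s) hs0
  rw [hd.deriv]
  field_simp
  ring

/-! ### The piece `E(x) = (ψ(x) - x)/(x log x)` -/

/-- `E(x) = (ψ(x) - x)/(x log x)` for `x ≥ 2` and `0` for `x < 2`: the linearised excess of
`log log ψ(x)` over `log log x`. [cite: Nicolas1983, §4] -/
def psiError (x : ℝ) : ℝ := if 2 ≤ x then (Chebyshev.psi x - x) / (x * Real.log x) else 0

/-- Auxiliary (proof-internal). [folklore] -/
theorem psiError_of_two_le {x : ℝ} (hx : 2 ≤ x) :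
    psiError x = (Chebyshev.psi x - x) / (x * Real.log x) := if_pos hx

/-- Auxiliary (proof-internal). [folklore] -/
theorem psiError_of_lt_two {x : ℝ} (hx : x < 2) : psiError x = 0 := if_neg (not_le.2 hx)

/-- Auxiliary (proof-internal). [folklore] -/
theorem measurable_psi : Measurable Chebyshev.psi := by
  have : Chebyshev.psi = (fun n : ℕ ↦ Chebyshev.psi n) ∘ Nat.floor := by
    funext x
    exact Chebyshev.psi_eq_psi_coe_floor x
  rw [this]
  exact (measurable_from_nat (f := fun n : ℕ ↦ Chebyshev.psi n)).comp Nat.measurable_floor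

/-- Auxiliary (proof-internal). [folklore] -/
theorem measurable_psiError : Measurable psiError := by
  unfold psiError
  refine Measurable.ite measurableSet_Ici ?_ measurable_const
  exact (measurable_psi.sub measurable_id).div (measurable_id.mul Real.measurable_log)

/-- `|ψ(x) - x| ≤ 6 x` for `x ≥ 0` (Chebyshev's bound `ψ(x) ≤ (log 4 + 4) x`). [folklore] -/
theorem abs_psi_sub_self_le {x : ℝ} (hx : 0 ≤ x) : |Chebyshev.psi x - x| ≤ 6 * x := by
  have h1 := Chebyshev.psi_le_const_mul_self hx
  have h2 := Chebyshev.psi_nonneg x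
  have hlog4 : Real.log 4 < 2 := by
    have : Real.log 4 = 2 * Real.log 2 := by
      rw [show (4 : ℝ) = 2 ^ 2 by norm_num, Real.log_pow]; norm_num
    rw [this]
    linarith [Real.log_two_lt_d9]
  rw [abs_le]
  constructor <;> nlinarith

/-- `|E(x)| ≤ 6 / log 2` everywhere. [folklore] -/
theorem abs_psiError_le (x : ℝ) : |psiError x| ≤ 6 / Real.log 2 := by
  have hl2 : 0 < Real.log 2 := Real.log_pos (by norm_num)
  by_cases hx : 2 ≤ x
  · rw [psiError_of_two_le hx, abs_div, abs_mul, abs_of_pos (show (0:ℝ) < x by linarith),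
      abs_of_pos (Real.log_pos (show (1:ℝ) < x by linarith))]
    have hlog : Real.log 2 ≤ Real.log x := Real.log_le_log (by norm_num) hx
    have hxl : 0 < x * Real.log x := mul_pos (by linarith) (by linarith)
    rw [div_le_div_iff₀ hxl hl2]
    calc |Chebyshev.psi x - x| * Real.log 2 ≤ 6 * x * Real.log 2 := by
          gcongr; exact abs_psi_sub_self_le (by linarith)
      _ ≤ 6 * (x * Real.log x) := by
          rw [mul_assoc]; gcongr
  · rw [psiError_of_lt_two (not_le.1 hx), abs_zero]
    positivity

/-- Auxiliary (proof-internal). [folklore] -/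
theorem integrableOn_psiError_rpow {σ : ℝ} (hσ : 0 < σ) :
    IntegrableOn (fun x ↦ psiError x * x ^ (-(σ + 1))) (Ioi 1) :=
  integrableOn_rpow_of_bounded measurable_psiError (fun x _ ↦ abs_psiError_le x) hσ

/-- `E(x) log x = (ψ(x) - x)/x` for `x ≥ 2`. [folklore] -/
theorem psiError_mul_log {x : ℝ} (hx : 2 ≤ x) :
    psiError x * Real.log x = (Chebyshev.psi x - x) / x := by
  rw [psiError_of_two_le hx]
  have hl : Real.log x ≠ 0 := (Real.log_pos (by linarith)).ne'
  have hx0 : x ≠ 0 := by linarith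
  field_simp

/-- `∫_2^∞ x^{-s-1} dx = 2^{-s}/s` for `Re s > 0`. [folklore] -/
theorem integral_Ioi_two_cpow {s : ℂ} (hs : 0 < s.re) :
    ∫ x in Ioi (2 : ℝ), (x : ℂ) ^ (-(s + 1)) = (2 : ℂ) ^ (-s) / s := by
  have hs0 : s ≠ 0 := by rintro rfl; simp at hs
  rw [integral_Ioi_cpow_of_lt (by simp; linarith) (by norm_num : (0:ℝ) < 2)]
  rw [show -(s + 1) + 1 = -s by ring]
  push_cast
  field_simp

/-- The kernel `e(s) = ζ'/ζ(1+s)/(s+1) + 2^{-s}/s`, written with its removable singularity at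
`s = 0` filled in: `e = dslope n 0 / (s+1)` with
`n(s) = s (Z₁'/Z₁)(s) - 1 + (s+1) 2^{-s}`, `Z₁(s) = s ζ(1+s)` (`zetaOne`), so that
`Z₁'/Z₁ = 1/s + ζ'/ζ(1+s)`. [cite: Nicolas1983, §4] -/
def psiKernelNum (s : ℂ) : ℂ :=
  s * (deriv zetaOne s / zetaOne s) - 1 + (s + 1) * (2 : ℂ) ^ (-s)

/-- See `psiKernelNum`. [cite: Nicolas1983, §4] -/
def psiKernel (s : ℂ) : ℂ := dslope psiKernelNum 0 s / (s + 1)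

/-- Auxiliary (proof-internal). [folklore] -/
@[simp] theorem psiKernelNum_zero : psiKernelNum 0 = 0 := by simp [psiKernelNum]

/-- Auxiliary (proof-internal). [folklore] -/
theorem psiKernel_of_ne_zero {s : ℂ} (hs : s ≠ 0) :
    psiKernel s = psiKernelNum s / (s * (s + 1)) := by
  rw [psiKernel, dslope_of_ne _ hs, slope_def_field, psiKernelNum_zero, sub_zero, sub_zero,
    div_div]

/-- The derivative of `zetaOne` away from `0`. [folklore] -/
theorem deriv_zetaOne {s : ℂ} (hs : s ≠ 0) :
    deriv zetaOne s = riemannZeta (1 + s) + s * deriv riemannZeta (1 + s) := by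
  have h1s : (1 : ℂ) + s ≠ 1 := by intro h; apply hs; linear_combination h
  have hev : zetaOne =ᶠ[𝓝 s] fun z ↦ z * riemannZeta (1 + z) := by
    filter_upwards [isOpen_ne.mem_nhds hs] with z hz
    exact zetaOne_of_ne_zero hz
  rw [hev.deriv_eq]
  have hd : HasDerivAt (fun z : ℂ ↦ z * riemannZeta (1 + z))
      (1 * riemannZeta (1 + s) + s * deriv riemannZeta (1 + s)) s := by
    refine (hasDerivAt_id s).mul ?_
    exact (differentiableAt_riemannZeta h1s).hasDerivAt.comp_const_add 1 s
  rw [hd.deriv, one_mul]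

/-- For `s ≠ 0` with `ζ(1+s) ≠ 0`: `Z₁'/Z₁ (s) = 1/s + ζ'/ζ(1+s)`. [folklore] -/
theorem deriv_zetaOne_div {s : ℂ} (hs : s ≠ 0) (hζ : riemannZeta (1 + s) ≠ 0) :
    deriv zetaOne s / zetaOne s = 1 / s + deriv riemannZeta (1 + s) / riemannZeta (1 + s) := by
  rw [deriv_zetaOne hs, zetaOne_of_ne_zero hs]
  field_simp

/-- For `s ≠ 0, -1` with `ζ(1+s) ≠ 0`, the kernel is `e(s) = ζ'/ζ(1+s)/(s+1) + 2^{-s}/s`.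
[folklore] -/
theorem psiKernel_eq {s : ℂ} (hs : s ≠ 0) (hs1 : s + 1 ≠ 0) (hζ : riemannZeta (1 + s) ≠ 0) :
    psiKernel s =
      deriv riemannZeta (1 + s) / riemannZeta (1 + s) / (s + 1) + (2 : ℂ) ^ (-s) / s := by
  rw [psiKernel_of_ne_zero hs, psiKernelNum, deriv_zetaOne_div hs hζ]
  field_simp
  ring

/-- **`∫_1^∞ E(x) log x · x^{-s-1} dx = -e(s)`** for `Re s > 0`: the logarithm cancels and
`∫_2^∞ (ψ(x) - x) x^{-s-2} dx = (-ζ'/ζ(1+s))/(1+s) - 2^{-s}/s`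
(`LSeries_vonMangoldt_eq_mul_integral_psi`). [cite: Nicolas1983, §4] -/
theorem mellinIoi_psiError_mul_log {s : ℂ} (hs : 0 < s.re) :
    mellinIoi (fun x ↦ psiError x * Real.log x) s = -psiKernel s := by
  have hs0 : s ≠ 0 := by rintro rfl; simp at hs
  have hs1 : s + 1 ≠ 0 := by
    intro h; have := congrArg Complex.re h; simp at this; linarith
  have h1s : 1 < (1 + s).re := by simp; linarith
  have hζ : riemannZeta (1 + s) ≠ 0 := riemannZeta_ne_zero_of_one_le_re (by simp; linarith)
  -- the integrand is `ψ(x) x^{-s-2} - 1_{x ≥ 2} x^{-s-1}` on `(1,∞)` (`ψ = 0` below `2`)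
  have hpt : ∀ x ∈ Ioi (1 : ℝ), ((psiError x * Real.log x : ℝ) : ℂ) * (x : ℂ) ^ (-(s + 1)) =
      (Chebyshev.psi x : ℂ) * (x : ℂ) ^ (-((1 + s) + 1)) -
        Set.indicator (Ici (2 : ℝ)) (fun x : ℝ ↦ (x : ℂ) ^ (-(s + 1))) x := by
    intro x hx
    have hx0 : (0 : ℝ) < x := zero_lt_one.trans hx
    have hx' : (x : ℂ) ≠ 0 := ofReal_ne_zero.2 hx0.ne'
    by_cases h2 : 2 ≤ x
    · rw [Set.indicator_of_mem (show x ∈ Ici (2:ℝ) from h2), psiError_mul_log h2]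
      rw [show -((1 + s) + 1) = -(s + 1) + (-1 : ℂ) by ring, cpow_add _ _ hx', cpow_neg_one]
      push_cast
      field_simp
    · push Not at h2
      rw [Set.indicator_of_notMem (show x ∉ Ici (2:ℝ) from fun h ↦ (not_le.2 h2) h),
        psiError_of_lt_two h2, Chebyshev.psi_eq_zero_of_lt_two h2]
      simp
  -- integrability of the two pieces on `(1, ∞)`
  have hint1 :
      IntegrableOn (fun x : ℝ ↦ (Chebyshev.psi x : ℂ) * (x : ℂ) ^ (-((1 + s) + 1))) (Ioi 1) := by
    have h : IntegrableOn (fun x : ℝ ↦ Chebyshev.psi x * x ^ (-((1 + s.re / 2) + 1))) (Ioi 1) := by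
      have h6 : ∀ x, 1 < x → |Chebyshev.psi x * x ^ (-(1:ℝ))| ≤ 7 := by
        intro x hx
        have hx0 : 0 < x := by linarith
        rw [Real.rpow_neg_one, abs_mul, abs_of_nonneg (Chebyshev.psi_nonneg x),
          abs_of_pos (inv_pos.2 hx0), ← div_eq_mul_inv, div_le_iff₀ hx0]
        have := abs_psi_sub_self_le hx0.le
        rw [abs_le] at this
        linarith [this.2]
      have h7 := integrableOn_rpow_of_bounded
        (show Measurable (fun x : ℝ ↦ Chebyshev.psi x * x ^ (-(1:ℝ))) from
          measurable_psi.mul (measurable_id.pow_const _)) h6 (σ := s.re / 2) (by linarith)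
      refine h7.congr_fun (fun x hx ↦ ?_) measurableSet_Ioi
      have hx0 : (0:ℝ) < x := zero_lt_one.trans hx
      simp only
      rw [mul_assoc, ← Real.rpow_add hx0]
      congr 2
      ring
    have h' := integrable_ofReal_mul_cpow measurable_psi h (s := 1 + s) (by simp; linarith)
    exact h'
  have hint2 : IntegrableOn (fun x : ℝ ↦ Set.indicator (Ici (2 : ℝ))
      (fun x : ℝ ↦ (x : ℂ) ^ (-(s + 1))) x) (Ioi 1) := by
    refine IntegrableOn.indicator ?_ measurableSet_Ici
    exact (integrableOn_Ioi_cpow_of_lt (by simp; linarith) zero_lt_one)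
  unfold mellinIoi
  rw [setIntegral_congr_fun measurableSet_Ioi hpt, integral_sub hint1 hint2,
    setIntegral_indicator measurableSet_Ici,
    show Ioi (1 : ℝ) ∩ Ici 2 = Ici 2 from
      Set.inter_eq_right.2 (fun x (hx : (2:ℝ) ≤ x) ↦ show (1 : ℝ) < x by linarith),
    integral_Ici_eq_integral_Ioi, integral_Ioi_two_cpow hs]
  -- the `ψ`-integral is `(-ζ'/ζ(1+s))/(1+s)`
  have h1s' : (1 : ℂ) + s ≠ 0 := by rw [add_comm]; exact hs1
  have hψ := neg_deriv_riemannZeta_div_eq_mul_integral_psi h1s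
  have hI : ∫ x in Ioi (1 : ℝ), (Chebyshev.psi x : ℂ) * (x : ℂ) ^ (-((1 + s) + 1)) =
      (-deriv riemannZeta (1 + s) / riemannZeta (1 + s)) / (1 + s) := by
    rw [hψ]
    field_simp
  rw [hI, psiKernel_eq hs0 hs1 hζ]
  field_simp
  ring

/-! ### The piece `A(x)`: `∫_1^∞ A(x) x^{-s-1} dx = L(s)/s` -/

/-- `A(x) x^{-(σ+1)}` is integrable on `(1,∞)` for `σ > 0` (`|A(x)| ≤ 2 (1 + log x)`). [folklore] -/
theorem integrableOn_mertensLog_rpow {σ : ℝ} (hσ : 0 < σ) :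
    IntegrableOn (fun x ↦ mertensLog x * x ^ (-(σ + 1))) (Ioi 1) := by
  refine integrableOn_rpow_of_le_log measurable_mertensLog (C := 2) (fun x hx ↦ ?_) hσ
  have h := abs_mertensLog_le x
  rwa [abs_of_nonneg (Real.log_nonneg hx.le)] at h

/-- **`∫_1^∞ A(x) x^{-s-1} dx = L(s)/s`** for `Re s > 0`, `L(s) = ∑ a_n n^{-s}`
(`primeLogLSeries_eq_mul_integral`). [cite: MontgomeryVaughan2007, §1.2, Thm. 1.3] -/
theorem mellinIoi_mertensLog {s : ℂ} (hs : 0 < s.re) :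
    mellinIoi mertensLog s = primeLogLSeries s / s := by
  have hs0 : s ≠ 0 := by rintro rfl; simp at hs
  rw [primeLogLSeries_eq_mul_integral hs, mellinIoi, mul_div_cancel_left₀ _ hs0]

/-- `∫_1^∞ A(x) log x · x^{-s-1} dx = -(L(s)/s)'` for `Re s > 0`. [folklore] -/
theorem mellinIoi_mertensLog_mul_log {s : ℂ} (hs : 0 < s.re) :
    mellinIoi (fun x ↦ mertensLog x * Real.log x) s =
      -deriv (fun z ↦ primeLogLSeries z / z) s := by
  have h1 : (0 : ℝ) < s.re / 2 := by linarith
  have h2 : s.re / 2 < s.re := by linarith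
  rw [mellinIoi_mul_log measurable_mertensLog (integrableOn_mertensLog_rpow h1) h2]
  congr 1
  refine Filter.EventuallyEq.deriv_eq ?_
  filter_upwards [(isOpen_re_gt 0).mem_nhds hs] with z hz
  exact mellinIoi_mertensLog hz

/-! ### Nicolas's comparison function `g` and its transform -/

/-- The comparison function `g(x) = c x^{-b} + γ + log log x + E(x) - A(x)`
(`E = psiError`, `A = mertensLog`). Up to the term `c x^{-b}`, `-g` is Nicolas's `log f(x)`,
`f(x) = e^γ log θ(x) ∏_{p ≤ x} (1 - 1/p)` (Thm. 3), with `θ` replaced by `ψ` and `log log ψ(x)`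
by its linearisation `log log x + (ψ(x) - x)/(x log x)` (an upper bound for it); the
`Ω₊`-statement behind Robin's Prop. 1 of §4 is that, when RH fails, `g` takes negative values for
arbitrarily large `x` (for suitable `b < 1/2` and every `c`).
[cite: Nicolas1983, §4, proof of Thm. 3 (c)] -/
def nicolasFn (b c : ℝ) (x : ℝ) : ℝ :=
  c * x ^ (-b) + Real.eulerMascheroniConstant + Real.log (Real.log x) + psiError x - mertensLog x

/-- `g₁ = g · log`, the function to which Landau's theorem is applied. [cite: Nicolas1983, §4] -/
def nicolasFnLog (b c : ℝ) (x : ℝ) : ℝ := nicolasFn b c x * Real.log x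

/-- Auxiliary (proof-internal). [folklore] -/
theorem measurable_nicolasFn (b c : ℝ) : Measurable (nicolasFn b c) := by
  unfold nicolasFn
  exact ((((measurable_const.mul (measurable_rpow_neg b)).add measurable_const).add
    measurable_loglog).add measurable_psiError).sub measurable_mertensLog

/-- Auxiliary (proof-internal). [folklore] -/
theorem measurable_nicolasFnLog (b c : ℝ) : Measurable (nicolasFnLog b c) :=
  (measurable_nicolasFn b c).mul Real.measurable_log

/-- `g x^{-(σ+1)}` is integrable on `(1,∞)` for `σ > 0` (`b > 0`). [folklore] -/
theorem integrableOn_nicolasFn_rpow {b c σ : ℝ} (hb : 0 < b) (hσ : 0 < σ) :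
    IntegrableOn (fun x ↦ nicolasFn b c x * x ^ (-(σ + 1))) (Ioi 1) := by
  have h1 := integrableOn_const_mul_rpow c (integrableOn_rpow_neg_rpow (b := b) (σ := σ)
    (by linarith))
  have h2 := integrableOn_const_rpow Real.eulerMascheroniConstant hσ
  have h3 := integrableOn_loglog_rpow hσ
  have h4 := integrableOn_psiError_rpow hσ
  have h5 := integrableOn_mertensLog_rpow hσ
  have := (((h1.add h2).add h3).add h4).sub h5
  refine this.congr_fun (fun x _ ↦ ?_) measurableSet_Ioi
  simp only [Pi.add_apply, Pi.sub_apply, nicolasFn]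
  ring

/-- `g₁ x^{-(σ+1)}` is integrable on `(1,∞)` for `σ > 0` (`b > 0`). [folklore] -/
theorem integrableOn_nicolasFnLog_rpow {b c σ : ℝ} (hb : 0 < b) (hσ : 0 < σ) :
    IntegrableOn (fun x ↦ nicolasFnLog b c x * x ^ (-(σ + 1))) (Ioi 1) :=
  integrableOn_mul_log_rpow (measurable_nicolasFn b c)
    (integrableOn_nicolasFn_rpow hb (half_pos hσ)) (σ := σ) (by linarith)

section pieces

variable {f g : ℝ → ℝ} {s : ℂ}

/-- Auxiliary (proof-internal). [folklore] -/
theorem integrable_add_ofReal_mul_cpow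
    (hf : Integrable (fun x : ℝ ↦ (f x : ℂ) * (x : ℂ) ^ (-(s + 1))) (volume.restrict (Ioi 1)))
    (hg : Integrable (fun x : ℝ ↦ (g x : ℂ) * (x : ℂ) ^ (-(s + 1))) (volume.restrict (Ioi 1))) :
    Integrable (fun x : ℝ ↦ ((f x + g x : ℝ) : ℂ) * (x : ℂ) ^ (-(s + 1)))
      (volume.restrict (Ioi 1)) := by
  refine (hf.add hg).congr (Eventually.of_forall fun x ↦ ?_)
  simp only [Pi.add_apply]
  push_cast
  ring

/-- Auxiliary (proof-internal). [folklore] -/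
theorem integrable_const_mul_ofReal_mul_cpow (c : ℝ)
    (hg : Integrable (fun x : ℝ ↦ (g x : ℂ) * (x : ℂ) ^ (-(s + 1))) (volume.restrict (Ioi 1))) :
    Integrable (fun x : ℝ ↦ ((c * g x : ℝ) : ℂ) * (x : ℂ) ^ (-(s + 1)))
      (volume.restrict (Ioi 1)) := by
  refine (hg.const_mul (c : ℂ)).congr (Eventually.of_forall fun x ↦ ?_)
  push_cast
  ring

end pieces

/-- **The transform of `g₁` for `Re s > 0`:**
`F₁(s) = c/(s+b)² + (1 - log s)/s² - e(s) + (L(s)/s)'`, the sum of the five pieces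
(`mellinIoi_rpow_neg_mul_log`, `mellinIoi_const_mul_log`, `mellinIoi_loglog_mul_log`,
`mellinIoi_psiError_mul_log`, `mellinIoi_mertensLog_mul_log`). [cite: Nicolas1983, §4] -/
theorem mellinIoi_nicolasFnLog_eq {b c : ℝ} (hb : 0 < b) {s : ℂ} (hs : 0 < s.re) :
    mellinIoi (nicolasFnLog b c) s =
      c / (s + b) ^ 2 + (1 - Complex.log s) / s ^ 2 - psiKernel s
        + deriv (fun z ↦ primeLogLSeries z / z) s := by
  -- the five pieces and their complex integrability at `s`
  set p1 : ℝ → ℝ := fun x ↦ x ^ (-b) * Real.log x with hp1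
  set p2 : ℝ → ℝ := fun x ↦ Real.eulerMascheroniConstant * Real.log x with hp2
  set p3 : ℝ → ℝ := fun x ↦ Real.log (Real.log x) * Real.log x with hp3
  set p4 : ℝ → ℝ := fun x ↦ psiError x * Real.log x with hp4
  set p5 : ℝ → ℝ := fun x ↦ mertensLog x * Real.log x with hp5
  have hσ : (0 : ℝ) < s.re / 2 := by linarith
  have hσ' : s.re / 2 < s.re := by linarith
  have hσ4 : (0 : ℝ) < s.re / 4 := by linarith
  have hσ4' : s.re / 4 < s.re / 2 := by linarith
  have I1 : Integrable (fun x : ℝ ↦ (p1 x : ℂ) * (x : ℂ) ^ (-(s + 1))) (volume.restrict (Ioi 1)) :=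
    integrable_ofReal_mul_cpow ((measurable_rpow_neg b).mul Real.measurable_log)
      (integrableOn_mul_log_rpow (measurable_rpow_neg b)
        (integrableOn_rpow_neg_rpow (b := b) (σ := s.re / 4) (by linarith)) hσ4') hσ'
  have I2 : Integrable (fun x : ℝ ↦ (p2 x : ℂ) * (x : ℂ) ^ (-(s + 1))) (volume.restrict (Ioi 1)) :=
    integrable_ofReal_mul_cpow (measurable_const.mul Real.measurable_log)
      (integrableOn_mul_log_rpow measurable_const
        (integrableOn_const_rpow Real.eulerMascheroniConstant hσ4) hσ4') hσ'
  have I3 : Integrable (fun x : ℝ ↦ (p3 x : ℂ) * (x : ℂ) ^ (-(s + 1))) (volume.restrict (Ioi 1)) :=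
    integrable_ofReal_mul_cpow (measurable_loglog.mul Real.measurable_log)
      (integrableOn_mul_log_rpow measurable_loglog (integrableOn_loglog_rpow hσ4) hσ4') hσ'
  have I4 : Integrable (fun x : ℝ ↦ (p4 x : ℂ) * (x : ℂ) ^ (-(s + 1))) (volume.restrict (Ioi 1)) :=
    integrable_ofReal_mul_cpow (measurable_psiError.mul Real.measurable_log)
      (integrableOn_mul_log_rpow measurable_psiError (integrableOn_psiError_rpow hσ4) hσ4') hσ'
  have I5 : Integrable (fun x : ℝ ↦ (p5 x : ℂ) * (x : ℂ) ^ (-(s + 1))) (volume.restrict (Ioi 1)) :=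
    integrable_ofReal_mul_cpow (measurable_mertensLog.mul Real.measurable_log)
      (integrableOn_mul_log_rpow measurable_mertensLog (integrableOn_mertensLog_rpow hσ4) hσ4')
      hσ'
  have I1c := integrable_const_mul_ofReal_mul_cpow c I1
  have I12 := integrable_add_ofReal_mul_cpow I1c I2
  have I123 := integrable_add_ofReal_mul_cpow I12 I3
  have I1234 := integrable_add_ofReal_mul_cpow I123 I4
  -- split the transform
  have hsplit : mellinIoi (nicolasFnLog b c) s =
      c * mellinIoi p1 s + mellinIoi p2 s + mellinIoi p3 s + mellinIoi p4 s - mellinIoi p5 s := by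
    have h0 : nicolasFnLog b c = fun x ↦ (c * p1 x + p2 x + p3 x + p4 x) - p5 x := by
      funext x
      simp only [nicolasFnLog, nicolasFn, hp1, hp2, hp3, hp4, hp5]
      ring
    rw [h0, mellinIoi_sub' I1234 I5, mellinIoi_add' I123 I4, mellinIoi_add' I12 I3,
      mellinIoi_add' I1c I2, mellinIoi_const_mul]
  rw [hsplit, hp1, hp2, hp3, hp4, hp5, mellinIoi_rpow_neg_mul_log (b := b) (by linarith),
    mellinIoi_const_mul_log _ hs, mellinIoi_loglog_mul_log hs, mellinIoi_psiError_mul_log hs,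
    mellinIoi_mertensLog_mul_log hs]
  have hs0 : s ≠ 0 := by rintro rfl; simp at hs
  field_simp
  ring

/-! ### Nicolas's function `N(s) = log(s ζ(1+s)) + D(s)` and the continuation `Φ₁` -/

/-- Nicolas's function `N(s) = log (s ζ(1+s)) + D(s)` (principal logarithm; `D = primeLogDiff`),
holomorphic wherever `Re s > -1/2` and `s ζ(1+s) ∉ (-∞, 0]`; `N(0) = 0`. For `Re s > 1`,
`N(s) = log s + ∑ a_n n^{-s}`. [cite: Nicolas1983, §4] -/
def nicolasN (s : ℂ) : ℂ := Complex.log (zetaOne s) + primeLogDiff s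

/-- Auxiliary (proof-internal). [folklore] -/
@[simp] theorem nicolasN_zero : nicolasN 0 = 0 := by simp [nicolasN, primeLogDiff_zero]

/-- `M = dslope N 0`: `M(s) = N(s)/s` for `s ≠ 0`, `M(0) = N'(0)`. [cite: Nicolas1983, §4] -/
def nicolasM : ℂ → ℂ := dslope nicolasN 0

/-- Auxiliary (proof-internal). [folklore] -/
theorem nicolasM_of_ne_zero {s : ℂ} (hs : s ≠ 0) : nicolasM s = nicolasN s / s := by
  rw [nicolasM, dslope_of_ne _ hs, slope_def_field, nicolasN_zero, sub_zero, sub_zero]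

/-- The domain `{Re s > -1/2} ∩ {s ζ(1+s) ∈ ℂ ∖ (-∞,0]}` of `N`: open, contains the half-plane
`Re s > 1` and the real ray `(-1/2, ∞)`. [folklore] -/
def nicolasDom : Set ℂ := {s : ℂ | -1 / 2 < s.re ∧ zetaOne s ∈ slitPlane}

/-- Auxiliary (proof-internal). [folklore] -/
theorem isOpen_nicolasDom : IsOpen nicolasDom :=
  (isOpen_re_gt' _).inter (isOpen_slitPlane.preimage continuous_zetaOne)

/-- Auxiliary (proof-internal). [folklore] -/
theorem mem_nicolasDom_of_one_lt_re {s : ℂ} (hs : 1 < s.re) : s ∈ nicolasDom :=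
  ⟨by linarith, zetaOne_mem_slitPlane hs⟩

/-- Auxiliary (proof-internal). [folklore] -/
theorem ofReal_mem_nicolasDom {σ : ℝ} (hσ : -1 / 2 < σ) : (σ : ℂ) ∈ nicolasDom :=
  ⟨by simpa using hσ, zetaOne_ofReal_mem_slitPlane (by linarith)⟩

/-- Auxiliary (proof-internal). [folklore] -/
theorem zero_mem_nicolasDom : (0 : ℂ) ∈ nicolasDom := by
  have := ofReal_mem_nicolasDom (σ := 0) (by norm_num)
  simpa using this

/-- Auxiliary (proof-internal). [folklore] -/
theorem zetaOne_ne_zero_of_mem_nicolasDom {s : ℂ} (hs : s ∈ nicolasDom) : zetaOne s ≠ 0 :=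
  slitPlane_ne_zero hs.2

/-- `N` is holomorphic on `nicolasDom`. [folklore] -/
theorem differentiableOn_nicolasN : DifferentiableOn ℂ nicolasN nicolasDom := by
  intro s hs
  refine DifferentiableAt.differentiableWithinAt ?_
  exact ((differentiable_zetaOne s).clog hs.2).add
    (differentiableOn_primeLogDiff.differentiableAt ((isOpen_re_gt' _).mem_nhds hs.1))

/-- `M` is holomorphic on `nicolasDom` (removable singularity at `0`). [folklore] -/
theorem differentiableOn_nicolasM : DifferentiableOn ℂ nicolasM nicolasDom :=
  (differentiableOn_dslope (isOpen_nicolasDom.mem_nhds zero_mem_nicolasDom)).2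
    differentiableOn_nicolasN

/-- `M'` is holomorphic on `nicolasDom`. [folklore] -/
theorem differentiableOn_deriv_nicolasM : DifferentiableOn ℂ (deriv nicolasM) nicolasDom :=
  (differentiableOn_nicolasM.analyticOnNhd isOpen_nicolasDom).deriv.differentiableOn

/-- `psiKernelNum` is holomorphic away from the zeros of `zetaOne`. [folklore] -/
theorem differentiableOn_psiKernelNum :
    DifferentiableOn ℂ psiKernelNum {s : ℂ | zetaOne s ≠ 0} := by
  intro s hs
  refine DifferentiableAt.differentiableWithinAt ?_
  unfold psiKernelNum
  refine ((differentiableAt_id.mul ?_).sub (differentiableAt_const _)).add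
    ((differentiableAt_id.add (differentiableAt_const _)).mul ?_)
  · exact ((analyticAt_zetaOne s).deriv.differentiableAt).div (differentiable_zetaOne s) hs
  · exact differentiableAt_id.neg.const_cpow (Or.inl two_ne_zero)

/-- Auxiliary (proof-internal). [folklore] -/
theorem isOpen_zetaOne_ne_zero : IsOpen {s : ℂ | zetaOne s ≠ 0} :=
  isOpen_ne_fun continuous_zetaOne continuous_const

/-- The kernel `e` is holomorphic away from the zeros of `zetaOne` and `s = -1`. [folklore] -/
theorem differentiableOn_psiKernel :
    DifferentiableOn ℂ psiKernel {s : ℂ | zetaOne s ≠ 0 ∧ s + 1 ≠ 0} := by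
  have h1 : DifferentiableOn ℂ (dslope psiKernelNum 0) {s : ℂ | zetaOne s ≠ 0} :=
    (differentiableOn_dslope (isOpen_zetaOne_ne_zero.mem_nhds (by simp))).2
      differentiableOn_psiKernelNum
  intro s hs
  have h2 : DifferentiableAt ℂ (dslope psiKernelNum 0) s :=
    h1.differentiableAt (isOpen_zetaOne_ne_zero.mem_nhds hs.1)
  exact (h2.div (differentiableAt_id.add (differentiableAt_const _)) hs.2).differentiableWithinAt

/-- Nicolas's continuation `Φ₁(s) = c/(s+b)² + M'(s) - e(s)` of the transform of `g₁`.
[cite: Nicolas1983, §4] -/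
def nicolasCont (b c : ℝ) (s : ℂ) : ℂ := c / (s + b) ^ 2 + deriv nicolasM s - psiKernel s

/-- `Φ₁` is holomorphic on `nicolasDom ∖ {-b}`. [cite: Nicolas1983, §4] -/
theorem differentiableOn_nicolasCont (b c : ℝ) :
    DifferentiableOn ℂ (nicolasCont b c) (nicolasDom \ {-(b : ℂ)}) := by
  intro s hs
  have hsb : s + b ≠ 0 := by
    intro h
    exact hs.2 (by rw [Set.mem_singleton_iff]; linear_combination h)
  have hD : s ∈ nicolasDom := hs.1
  refine DifferentiableAt.differentiableWithinAt ?_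
  unfold nicolasCont
  refine (DifferentiableAt.add ?_ ?_).sub ?_
  · refine (differentiableAt_const _).div
      ((differentiableAt_id.add (differentiableAt_const _)).pow 2) ?_
    exact pow_ne_zero 2 hsb
  · exact differentiableOn_deriv_nicolasM.differentiableAt (isOpen_nicolasDom.mem_nhds hD)
  · refine differentiableOn_psiKernel.differentiableAt (IsOpen.mem_nhds ?_ ⟨?_, ?_⟩)
    · exact (isOpen_zetaOne_ne_zero).inter (isOpen_ne_fun (continuous_id.add continuous_const)
        continuous_const)
    · exact zetaOne_ne_zero_of_mem_nicolasDom hD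
    · intro h
      have := congrArg Complex.re h
      simp at this
      linarith [hD.1]

/-- For `Re s > 1`: `M'(s) = (1 - log s)/s² + (L(s)/s)'`, because there
`M(z) = N(z)/z = (log z + L(z))/z` (`log_zetaOne_eq`, `primeLogDiff_eq`). [cite: Nicolas1983, §4] -/
theorem deriv_nicolasM_eq {s : ℂ} (hs : 1 < s.re) :
    deriv nicolasM s = (1 - Complex.log s) / s ^ 2 + deriv (fun z ↦ primeLogLSeries z / z) s := by
  have hs0 : s ≠ 0 := by rintro rfl; simp at hs; linarith
  have hev : nicolasM =ᶠ[𝓝 s] fun z ↦ Complex.log z / z + primeLogLSeries z / z := by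
    filter_upwards [(isOpen_re_gt' 1).mem_nhds hs] with z hz
    have hz' : 1 < z.re := hz
    have hz0 : z ≠ 0 := by rintro rfl; simp at hz'; linarith
    rw [nicolasM_of_ne_zero hz0, nicolasN, log_zetaOne_eq hz', primeLogDiff_eq (by linarith)]
    ring
  rw [hev.deriv_eq]
  have hd1 : HasDerivAt (fun z ↦ Complex.log z / z) ((s⁻¹ * s - Complex.log s * 1) / s ^ 2) s :=
    (Complex.hasDerivAt_log (Or.inl (by linarith))).div (hasDerivAt_id s) hs0
  have hdL : DifferentiableAt ℂ (fun z ↦ primeLogLSeries z / z) s :=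
    (differentiableOn_primeLogLSeries.differentiableAt
      ((isOpen_re_gt' 0).mem_nhds (show (0:ℝ) < s.re by linarith))).div differentiableAt_id hs0
  have hsum : HasDerivAt (fun z ↦ Complex.log z / z + primeLogLSeries z / z)
      ((s⁻¹ * s - Complex.log s * 1) / s ^ 2 + deriv (fun z ↦ primeLogLSeries z / z) s) s :=
    hd1.add hdL.hasDerivAt
  rw [hsum.deriv]
  congr 1
  field_simp

/-- **`F₁ = Φ₁` on `Re s > 1`**: `∫_1^∞ g(x) log x · x^{-s-1} dx = c/(s+b)² + M'(s) - e(s)`.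
[cite: Nicolas1983, §4] -/
theorem mellinIoi_nicolasFnLog {b c : ℝ} (hb : 0 < b) {s : ℂ} (hs : 1 < s.re) :
    mellinIoi (nicolasFnLog b c) s = nicolasCont b c s := by
  rw [mellinIoi_nicolasFnLog_eq hb (by linarith), nicolasCont, deriv_nicolasM_eq hs]
  ring

/-! ### Landau's theorem applied to `g₁` -/

/-- A convex open neighbourhood `W₀` of the real segment `(-b, 2]` inside `nicolasDom ∖ {-b}`
(a metric thickening of `[-b, 2]`, cut by `Re s > -b`; it exists because `s ζ(1+s)` is real and
positive on `(-1/2, ∞)`, by compactness). [folklore] -/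
theorem exists_convex_nhd_segment {b : ℝ} (hb : b < 1 / 2) :
    ∃ W₀ : Set ℂ, IsOpen W₀ ∧ Convex ℝ W₀ ∧ (∀ σ : ℝ, -b < σ → σ ≤ 2 → (σ : ℂ) ∈ W₀) ∧
      W₀ ⊆ nicolasDom \ {-(b : ℂ)} := by
  set K : Set ℂ := Icc (-b) 2 ×ℂ {0} with hK
  have hKc : IsCompact K := isCompact_Icc.reProdIm isCompact_singleton
  have hKconv : Convex ℝ K :=
    ((convex_Icc _ _).linear_preimage Complex.reLm).inter
      ((convex_singleton (0 : ℝ)).linear_preimage Complex.imLm)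
  have hKsub : K ⊆ nicolasDom := by
    intro z hz
    rw [hK, mem_reProdIm] at hz
    have him : z.im = 0 := hz.2
    have hz' : z = ((z.re : ℝ) : ℂ) := Complex.ext (by simp) (by simp [him])
    rw [hz']
    exact ofReal_mem_nicolasDom (by linarith [hz.1.1])
  obtain ⟨δ, hδ, hsub⟩ := hKc.exists_thickening_subset_open isOpen_nicolasDom hKsub
  refine ⟨Metric.thickening δ K ∩ {s : ℂ | -b < s.re},
    Metric.isOpen_thickening.inter (isOpen_re_gt' _),
    (hKconv.thickening δ).inter (convex_halfSpace_re_gt _), fun σ h1 h2 ↦ ⟨?_, by simpa using h1⟩,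
    fun s hs ↦ ⟨hsub hs.1, ?_⟩⟩
  · refine Metric.self_subset_thickening hδ K ?_
    rw [hK, mem_reProdIm]
    exact ⟨⟨by simpa using h1.le, by simpa using h2⟩, by simp⟩
  · intro h
    rw [Set.mem_singleton_iff] at h
    have := hs.2
    rw [h] at this
    simp only [Set.mem_setOf_eq, neg_re, ofReal_re] at this
    linarith

/-- **Landau's theorem applied to `g₁`** (MV Lemma 15.1, abscissa form, with `σ₁ = 1`, `a = -b`
and `Φ = Φ₁`): if `g ≥ 0` on `(X₁, ∞)` then `∫_1^∞ |g(x)| log x · x^{-σ-1} dx < ∞` for every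
`σ > -b`. [cite: Nicolas1983, §4, proof of Thm. 3 (c)] -/
theorem integrableOn_nicolasFnLog_of_nonneg {b c : ℝ} (hb0 : 0 < b) (hb : b < 1 / 2) {X₁ : ℝ}
    (hX₁ : 1 ≤ X₁) (hpos : ∀ x, X₁ < x → 0 ≤ nicolasFn b c x) {σ : ℝ} (hσ : -b < σ) :
    IntegrableOn (fun x ↦ nicolasFnLog b c x * x ^ (-(σ + 1))) (Ioi 1) := by
  obtain ⟨W₀, hW₀o, hW₀c, hW₀r, hW₀sub⟩ := exists_convex_nhd_segment hb
  refine integrableOn_of_differentiableOn_union_convex (measurable_nicolasFnLog b c) (σ₁ := 1)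
    (a := -b) (X₁ := X₁) (integrableOn_nicolasFnLog_rpow hb0 one_pos) hX₁ (fun x hx ↦ ?_)
    (by linarith) hW₀o hW₀c (fun σ' h1 h2 ↦ hW₀r σ' h1 (by linarith)) (Φ := nicolasCont b c)
    ?_ ?_ hσ
  · exact mul_nonneg (hpos x hx) (Real.log_nonneg (by linarith))
  · refine (differentiableOn_nicolasCont b c).mono ?_
    rintro s (hs | hs)
    · have hs' : 1 < s.re := hs
      refine ⟨mem_nicolasDom_of_one_lt_re hs', fun h ↦ ?_⟩
      rw [Set.mem_singleton_iff] at h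
      rw [h] at hs'
      simp at hs'
      linarith
    · exact hW₀sub hs
  · intro s hs
    exact (mellinIoi_nicolasFnLog hb0 hs).symm

/-- Consequently, if `g ≥ 0` eventually then `F₁` is holomorphic on the half-plane `Re s > -b`.
[cite: Nicolas1983, §4, proof of Thm. 3 (c)] -/
theorem differentiableOn_mellinIoi_nicolasFnLog_of_nonneg {b c : ℝ} (hb0 : 0 < b) (hb : b < 1 / 2)
    {X₁ : ℝ} (hX₁ : 1 ≤ X₁) (hpos : ∀ x, X₁ < x → 0 ≤ nicolasFn b c x) :
    DifferentiableOn ℂ (mellinIoi (nicolasFnLog b c)) {s : ℂ | -b < s.re} :=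
  differentiableOn_mellinIoi_of_forall (measurable_nicolasFnLog b c) fun _ hσ ↦
    integrableOn_nicolasFnLog_of_nonneg hb0 hb hX₁ hpos hσ

end Nicolas

end Literature.NumberTheory.LFunctions

end
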